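import Literature.Probability.LatticeModels.GridDomainExitPath
import Literature.Probability.LatticeModels.GridDomainConformalBarrier
import Literature.Probability.LatticeModels.GridDomainBoundaryHittingIteration
import Literature.Analysis.Complex.HarmonicSqrtLatticeMean
import Mathlib.Analysis.Real.Pi.Bounds
import HarnessLib

/-!
# Boundary hitting in grid domains: the proof of LSW 2004, Lemma 5.3 (`boundaryHitting_holds`)

Topic `Literature/Probability/LatticeModels`; the last sibling of `GridDomainHittingProbability.lean`,
discharging its named fact `boundaryHitting` (G. F. Lawler, O. Schramm, W. Werner, *Conformal
invariance of planar loop-erased random walks and uniform spanning trees*, Ann. Probab. 32 (2004),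
Lemma 5.3; arXiv math/0112234, Lemma 33): **for every `ε₁, ε₂ > 0` there is `δ > 0` such that for
all `D ∈ 𝔇` and `w ∈ V(D)` with `|ψ_D(w)| ≥ 1 - δ`, simple random walk from `w` hits
`{v : |ψ_D(v) - ψ_D(w)| > ε₁}` before `∂D` with probability at most `ε₂`.**

The printed proof has two halves. The second half — iterate a one-round statement using the Koebe
step `1 - |ψ(v₂)| ≤ c (1 - |ψ(v₁)|)` and the Markov property — is
`LSWGrid.boundaryHitting_of_oneRound` (`GridDomainBoundaryHittingIteration.lean`). The first half is
the **one-round lemma** `LSWGrid.oneRound` proved here: there are universal `M, c₂, δ₀ > 0` such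
that from any `w ∈ V(D)` with `η = 1 - |ψ w| ≤ δ₀` the walk is killed at `∂D` before leaving a
finite set `N ∋ w` of sites conformally within `M η` of `w`, with probability `≥ c₂`. The printed
argument for this half (three channels `K₁, K₂, K₃`, conformal invariance of Brownian harmonic
measure, and the convergence of the walk to Brownian motion for `r > r₀`) is replaced in the tree
by a shorter road through results the tree already has, all proved:

1. *(Case A, bounded scales — "two grid paths of bounded length".)* If the Koebe radius
   `ρ_K(w) = (1 - |ψ w|²)/(4|ψ'(w)|)` is `< R₀`, then `dist(w, ∂D) < 4 R₀` (Schwarz–Pick,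
   `le_four_mul_koebeRadius`), a lattice point off `V(D)` lies within `4R₀ + 1`, and the walk
   follows a monotone lattice path to it with probability `≥ 4^{-2 m_A}` while moving conformally by
   at most `(15^{2m_A} - 1) η` (`hitBeforeExitProb_le_of_near_boundary`, `GridDomainExitPath.lean`).
2. *(Case B, the barrier.)* Otherwise compare, on the finite set
   `W = {v ∈ V(D) ∩ Box₁ : ρ_K(v) ≥ R₀, U(v) < 1/2}`, the killed-harmonic function
   `h_B = hitBeforeExitProb D · (V ∖ N)` with the killed-superharmonic majorant
   `Ŝ = 1 - c_A (1 - √2 √(min(U, 1/2)) - β)`; here `U = im barrierQ` is the harmonic measure of the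
   far boundary arc in conformal coordinates (`GridDomainConformalBarrier.lean`: `U(w) ≤ 1/32`,
   `U < 1/2 ⟹ |ψ - ψ w| ≤ 65 η`, and the relative gradient bound `U ≤ π |barrierQ'| ρ_K`), `√U` is
   lattice-superharmonic where `ρ_K ≥ R₀` by the four-point estimate
   `Literature.Analysis.Complex.sqrt_im_fourPointSum_le` (`HarmonicSqrtLatticeMean.lean`: Harnack,
   Cauchy estimates, Koebe), and `β = hitBeforeExitProb D · (V ∖ Box₁) ≤ 1/4` at `w` is the weak
   Beurling estimate for the killed walk (`GridDomainBeurling.lean`, Kesten/Smirnov through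
   `weakBeurling_of_noCircuit` and simple connectivity). On the outer boundary of `W` one has
   `h_B ≤ Ŝ` (outside `Box₁`: `β = 1`; where `U ≥ 1/2`: `√2 √(1/2) = 1`; where `ρ_K < R₀`: Case A),
   so the comparison principle (`KilledWalkLaplacian.le_of_killedSub_killedSuper_of_boundary`)
   gives `h_B(w) ≤ Ŝ(w) ≤ 1 - c_A/2`.

* `LSWGrid.oneRound` — the one-round lemma with `M = 66 · 15^{2 m_A}`, `c₂ = 4^{-2 m_A}/2`,
  `δ₀ = 1/2` (`R₀ = 1260`, `m_A = 5041`);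
* `Literature.Probability.LatticeModels.boundaryHitting_holds : boundaryHitting`.

## References

* G. F. Lawler, O. Schramm, W. Werner, Ann. Probab. 32 (2004) 939–995, §5.1, Lemma 5.3
  [LawlerSchrammWerner2004].
* S. Smirnov, Ann. of Math. 172 (2010), App. B, Lemma B.2 (weak Beurling) [Smirnov2010].
* Ch. Pommerenke, *Boundary Behaviour of Conformal Maps* (1992), Cor. 1.4 (Koebe) [PommerenkeBBCM1992].
* G. F. Lawler, V. Limic, *Random Walk: A Modern Introduction* (2010), §6.1 (maximum principle for
  the killed walk) [LawlerLimic2010].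
-/

noncomputable section

open Set Metric Filter Complex
open scoped Classical Topology Real
open Literature.Probability.RandomPlanarGeometry (ChordalLERW.siteGraph ChordalLERW.siteGraph_adj_iff)

namespace Literature.Probability.LatticeModels

open WeakBeurling (sqBox mem_sqBox sqBox_mono sqBox_finite mem_sqBox_succ_of_adj)

namespace LSWGrid

variable {D : Set ℂ}

/-! ### Boxes -/

/-- Every site lies in some box about `p`. [folklore] -/
theorem mem_sqBox_toNat (p w : Site 2) : w ∈ sqBox p ((max |w 0 - p 0| |w 1 - p 1|).toNat : ℕ) := by
  rw [mem_sqBox]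
  have h := Int.self_le_toNat (max |w 0 - p 0| |w 1 - p 1|)
  exact ⟨(le_max_left _ _).trans h, (le_max_right _ _).trans h⟩

/-! ### The barrier at the starting point and on its sub-level set `U < 1/2` -/

/-- **The barrier is small at the starting point**: with `a = 32 η/(2-η)`,
`uhpBarrier a (cayleyAt b ((1-η) b)) ≤ 1/32`. [folklore] -/
theorem uhpBarrier_start_le {b : ℂ} (hb : ‖b‖ = 1) {η : ℝ} (hη0 : 0 < η) (hη : η ≤ 1 / 2) :
    uhpBarrier (32 * (η / (2 - η))) (cayleyAt b ((1 - η : ℝ) * b)) ≤ 1 / 32 := by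
  set η' : ℝ := η / (2 - η) with hη'
  have hη'0 : 0 < η' := div_pos hη0 (by linarith)
  set a : ℝ := 32 * η' with ha
  have ha0 : 0 < a := by positivity
  rw [cayleyAt_radial hb (by linarith)]
  have him : (I * (η' : ℂ)).im = η' := by simp
  have hz : 0 < (I * (η' : ℂ)).im := by rwa [him]
  have hnorm : ‖I * (η' : ℂ)‖ < a := by
    rw [norm_mul, Complex.norm_I, one_mul, Complex.norm_real, Real.norm_of_nonneg hη'0.le, ha]
    linarith
  refine (uhpBarrier_le_of_norm_lt ha0 hz hnorm).trans ?_
  rw [him]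
  have h1 : a ≤ ‖I * (η' : ℂ) - a‖ := by
    have := Complex.abs_re_le_norm (I * (η' : ℂ) - a)
    simp only [sub_re, mul_re, I_re, ofReal_re, zero_mul, I_im, ofReal_im, mul_zero, sub_zero,
      zero_sub, abs_neg, abs_of_pos ha0] at this
    exact this
  have h2 : a ≤ ‖I * (η' : ℂ) + a‖ := by
    have := Complex.abs_re_le_norm (I * (η' : ℂ) + a)
    simp only [add_re, mul_re, I_re, ofReal_re, zero_mul, I_im, ofReal_im, mul_zero, sub_zero,
      zero_add, abs_of_pos ha0] at this
    exact this
  calc a * η' / (‖I * (η' : ℂ) - a‖ * ‖I * (η' : ℂ) + a‖) ≤ a * η' / (a * a) := by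
        apply div_le_div_of_nonneg_left (by positivity) (by positivity)
        exact mul_le_mul h1 h2 ha0.le (norm_nonneg _)
    _ = 1 / 32 := by rw [ha]; field_simp

/-- On the sub-level set `U < 1/2` the disc variable is within `2a` of the boundary point `b`. [folklore] -/
theorem norm_sub_lt_of_uhpBarrier_lt_half {b ζ : ℂ} (hb : ‖b‖ = 1) {a : ℝ} (ha : 0 < a) (hζ : ‖ζ‖ < 1)
    (hU : uhpBarrier a (cayleyAt b ζ) < 1 / 2) : ‖b - ζ‖ < 2 * a := by
  have hlt := (uhpBarrier_lt_half_iff ha (cayleyAt_im_pos hb hζ)).1 hU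
  linarith [norm_sub_le_two_mul_norm_cayleyAt hb hζ]

/-! ### The barrier is lattice-superharmonic where the Koebe radius is large -/

/-- `400 π ≤ 1260`. [folklore] -/
theorem four_hundred_pi_le : 400 * π ≤ 1260 := by
  have := Real.pi_lt_d2; linarith

/-- The four lattice neighbours in complex coordinates. [folklore] -/
theorem sum_dir_toComplex (f : ℂ → ℝ) (v : Site 2) :
    ∑ e : SRW.Dir 2, f (Site.toComplex (v + SRW.stepVec e)) =
      f (Site.toComplex v + 1) + f (Site.toComplex v + I) + f (Site.toComplex v - 1) + f (Site.toComplex v - I) := by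
  have h0 : Site.toComplex (v + SRW.stepVec ((0, true) : SRW.Dir 2)) = Site.toComplex v + 1 :=
    Complex.ext (by simp [Site.toComplex, SRW.stepVec_apply]) (by simp [Site.toComplex, SRW.stepVec_apply])
  have h1 : Site.toComplex (v + SRW.stepVec ((0, false) : SRW.Dir 2)) = Site.toComplex v - 1 :=
    Complex.ext (by simp [Site.toComplex, SRW.stepVec_apply, sub_eq_add_neg])
      (by simp [Site.toComplex, SRW.stepVec_apply])
  have h2 : Site.toComplex (v + SRW.stepVec ((1, true) : SRW.Dir 2)) = Site.toComplex v + I :=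
    Complex.ext (by simp [Site.toComplex, SRW.stepVec_apply]) (by simp [Site.toComplex, SRW.stepVec_apply])
  have h3 : Site.toComplex (v + SRW.stepVec ((1, false) : SRW.Dir 2)) = Site.toComplex v - I :=
    Complex.ext (by simp [Site.toComplex, SRW.stepVec_apply])
      (by simp [Site.toComplex, SRW.stepVec_apply, sub_eq_add_neg])
  rw [Fintype.sum_prod_type, Fin.sum_univ_two, Fintype.sum_bool, Fintype.sum_bool, h0, h1, h2, h3]
  ring

/-- **The square root of the barrier is lattice-superharmonic where the Koebe radius is `≥ 1260`
and the barrier is `< 1/2`** (the four-point estimate `sqrt_im_fourPointSum_le` with `c = 1/π`,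
`R = ρ_K(v)`, on the Koebe disc `B(v, ρ_K(v)) ⊆ D`). [folklore] -/
theorem sum_sqrt_barrierQ_im_le (hD : IsOpen D) {ψ : ℂ → ℂ} (hψ : IsDiscMap D ψ) {b : ℂ} (hb : ‖b‖ = 1)
    {a : ℝ} (ha : 0 < a) {v : Site 2} (hv : v ∈ latticeVertices D)
    (hR : 1260 ≤ koebeRadius ψ (Site.toComplex v)) (hU : (barrierQ b a ψ (Site.toComplex v)).im < 1 / 2) :
    ∑ e : SRW.Dir 2, √(barrierQ b a ψ (Site.toComplex (v + SRW.stepVec e))).im ≤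
      4 * √(barrierQ b a ψ (Site.toComplex v)).im := by
  set x := Site.toComplex v with hx
  set R := koebeRadius ψ x with hRdef
  have hball : ball x R ⊆ D := ball_koebeRadius_subset hD hψ hv
  have hlt : ∀ z ∈ D, ‖ψ z‖ < 1 := fun z hz => hψ.norm_lt_one hz
  have hdQ : DifferentiableOn ℂ (barrierQ b a ψ) (ball x R) :=
    (differentiableOn_barrierQ hb ha hψ.1 hlt).mono hball
  have hpos : ∀ z ∈ ball x R, 0 < (barrierQ b a ψ z).im := fun z hz =>
    (barrierQ_im_mem_Ioo hb ha (hlt z (hball hz))).1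
  have hψ' : deriv ψ x ≠ 0 :=
    Literature.Analysis.Complex.SCV.deriv_ne_zero_of_injOn hψ.1 hD hψ.2.1.injOn hv
  have hgrad := barrierQ_im_le_mul_norm_deriv hb ha hD hψ.1 hv (hlt x hv) hψ' hU
  have hR8 : 8 ≤ R := by linarith
  have hcR : 400 ≤ π⁻¹ * R := by
    rw [le_inv_mul_iff₀ Real.pi_pos]
    linarith [four_hundred_pi_le]
  have hgrad' : π⁻¹ * (barrierQ b a ψ x).im ≤ ‖deriv (barrierQ b a ψ) x‖ * R := by
    rw [inv_mul_le_iff₀ Real.pi_pos]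
    linarith
  have key := Literature.Analysis.Complex.sqrt_im_fourPointSum_le hR8 hdQ hpos hcR hgrad'
  rw [sum_dir_toComplex (fun z => √(barrierQ b a ψ z).im) v]
  exact key

/-! ### Case A is available where the Koebe radius is small -/

/-- If `ρ_K(y) < 1260` at a vertex `y ∈ V(D)`, some lattice point off `V(D)` lies in
`sqBox y 5041` (`dist(y, ∂D) ≤ 4 ρ_K(y)`). [folklore] -/
theorem exists_not_mem_of_koebeRadius_lt (hD : IsClassD D) {ψ : ℂ → ℂ} (hψ : IsDiscMap D ψ)
    {y : Site 2} (hy : y ∈ latticeVertices D) (hR : koebeRadius ψ (Site.toComplex y) < 1260) :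
    ∃ q : Site 2, q ∉ latticeVertices D ∧ q ∈ sqBox y (5041 : ℕ) := by
  have hopen : IsOpen D := hD.1.1
  set x := Site.toComplex y with hx
  set s := infDist x Dᶜ with hs
  have hball : ball x s ⊆ D := ball_infDist_compl_subset
  have hcne : (Dᶜ : Set ℂ).Nonempty := nonempty_compl.2 hD.2.2.2
  have hs0 : 0 < s := by
    rw [hs, ← infDist_pos_iff_notMem_closure hcne, hopen.isClosed_compl.closure_eq]
    exact fun h => h hy
  have hψ' : deriv ψ x ≠ 0 :=
    Literature.Analysis.Complex.SCV.deriv_ne_zero_of_injOn hψ.1 hopen hψ.2.1.injOn hy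
  have h4 := le_four_mul_koebeRadius hs0 (hψ.1.mono hball) (hψ.2.1.mapsTo.mono_left hball) hψ'
  have hs' : infDist x Dᶜ < (5040 : ℝ) := by rw [← hs]; linarith
  obtain ⟨q, hq, hqbox⟩ := exists_not_mem_latticeVertices_mem_sqBox hD.1 hD.2.2.2 hy hs'
  refine ⟨q, hq, ?_⟩
  have : ⌊(5040 : ℝ)⌋₊ + 1 = 5041 := by norm_num
  rwa [this] at hqbox

/-! ### The one-round lemma -/

/-- **The one-round lemma** (the "restricted case `ε₂` close to `1`" of LSW Lemma 5.3, in the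
linear form consumed by `boundaryHitting_of_oneRound`): there are universal `M ≥ 0`,
`c₂ ∈ (0, 1]`, `δ₀ > 0` such that for every `D ∈ 𝔇`, every disc map `ψ` of `D` and every
`w ∈ V(D)` with `η = 1 - |ψ w| ≤ δ₀` there is a finite set `N ∋ w` of sites, all of whose points in
`V(D)` are conformally within `M η` of `w`, which the walk from `w` leaves before being killed with
probability at most `1 - c₂`. [cite: LawlerSchrammWerner2004, §5.1, proof of Lemma 5.3] -/
theorem oneRound : ∃ M c₂ δ₀ : ℝ, 0 ≤ M ∧ 0 < c₂ ∧ c₂ ≤ 1 ∧ 0 < δ₀ ∧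
    ∀ D : Set ℂ, IsClassD D → ∀ ψ : ℂ → ℂ, IsDiscMap D ψ → ∀ w ∈ latticeVertices D,
      1 - ‖ψ (Site.toComplex w)‖ ≤ δ₀ → ∃ N : Set (Site 2), N.Finite ∧ w ∈ N ∧
        (∀ v ∈ N, v ∈ latticeVertices D →
          ‖ψ (Site.toComplex v) - ψ (Site.toComplex w)‖ ≤ M * (1 - ‖ψ (Site.toComplex w)‖)) ∧
        hitBeforeExitProb D w (latticeVertices D \ N) ≤ 1 - c₂ := by
  obtain ⟨K, hK0, hK⟩ := exists_hitBeforeExitProb_compl_sqBox_le (ε := 1 / 4) (by norm_num)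
  -- `mA = 5041` is kept abstract (tactics must not evaluate `15 ^ (2 mA)`)
  obtain ⟨mA, hmA⟩ : ∃ m : ℕ, m = 5041 := ⟨_, rfl⟩
  set cA : ℝ := 4⁻¹ ^ (2 * mA) with hcA
  have hcA0 : 0 < cA := by positivity
  have hcA1 : cA ≤ 1 := pow_le_one₀ (by norm_num) (by norm_num)
  set M : ℝ := 66 * 15 ^ (2 * mA) with hM
  have hM1 : (66 : ℝ) ≤ M := by
    have : (1 : ℝ) ≤ 15 ^ (2 * mA) := one_le_pow₀ (by norm_num)
    rw [hM]; nlinarith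
  refine ⟨M, cA / 2, 1 / 2, by positivity, by positivity, by linarith, by norm_num, ?_⟩
  intro D hD ψ hψ w hw hηle
  have hgrid : IsGridDomain D := hD.1
  have hsc : IsSimplyConnected D := hD.2.1
  have hopen : IsOpen D := hD.1.1
  set V := latticeVertices D with hV
  have hmaps : MapsTo ψ D (ball 0 1) := hψ.2.1.mapsTo
  have hlt : ∀ z ∈ D, ‖ψ z‖ < 1 := fun z hz => hψ.norm_lt_one hz
  set η : ℝ := 1 - ‖ψ (Site.toComplex w)‖ with hη
  have hη0 : 0 < η := by have := hlt _ hw; rw [hη]; linarith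
  have hη2 : η ≤ 1 / 2 := hηle
  -- an exterior lattice point and the boxes
  obtain ⟨p, hp⟩ := exists_not_mem_latticeVertices hgrid ⟨0, hD.2.2.1⟩ hD.2.2.2
  set ρ : ℕ := (max |w 0 - p 0| |w 1 - p 1|).toNat with hρ
  have hwρ : w ∈ sqBox p ρ := mem_sqBox_toNat p w
  set R₁ : ℕ := K * (ρ + 1) with hR₁
  have hρR₁ : (ρ : ℤ) ≤ (R₁ : ℕ) := by
    have : ρ ≤ K * (ρ + 1) := by nlinarith
    exact_mod_cast this
  have hwR₁ : w ∈ sqBox p R₁ := sqBox_mono p hρR₁ hwρ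
  set R₃ : ℕ := R₁ + 1 + 2 * mA with hR₃
  have hR₁R₃ : ((R₁ : ℕ) : ℤ) ≤ (R₃ : ℕ) := by rw [hR₃]; push_cast; linarith
  have hR₁R₃' : (((R₁ + 1 : ℕ)) : ℤ) ≤ (R₃ : ℕ) := by rw [hR₃]; push_cast; linarith
  -- the barrier
  set ζw : ℂ := ψ (Site.toComplex w) with hζw
  have hζwn : ‖ζw‖ = 1 - η := by rw [hη]; ring
  have hζw0 : ζw ≠ 0 := by
    rw [← norm_pos_iff, hζwn]; linarith
  set b : ℂ := ((‖ζw‖⁻¹ : ℝ) : ℂ) * ζw with hb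
  have hbn : ‖b‖ = 1 := by
    rw [hb, norm_mul, Complex.norm_real, Real.norm_of_nonneg (inv_nonneg.2 (norm_nonneg _)),
      inv_mul_cancel₀ (norm_ne_zero_iff.2 hζw0)]
  have hζwb : ζw = ((1 - η : ℝ) : ℂ) * b := by
    rw [← hζwn, hb, ← mul_assoc, ← Complex.ofReal_mul, mul_inv_cancel₀ (norm_ne_zero_iff.2 hζw0)]
    simp
  set a : ℝ := 32 * (η / (2 - η)) with ha
  have ha0 : 0 < a := by rw [ha]; exact mul_pos (by norm_num) (div_pos hη0 (by linarith))
  have ha64 : 2 * a ≤ 64 * η := by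
    rw [ha]
    have : η / (2 - η) ≤ η := by
      rw [div_le_iff₀ (by linarith)]; nlinarith
    linarith
  set U : ℂ → ℝ := fun z => (barrierQ b a ψ z).im with hU
  have hUw : U (Site.toComplex w) < 1 / 2 ∧ U (Site.toComplex w) ≤ 1 / 32 := by
    have : U (Site.toComplex w) ≤ 1 / 32 := by
      show (barrierQ b a ψ (Site.toComplex w)).im ≤ 1 / 32
      rw [barrierQ_im, ← hζw, hζwb, ha]
      exact uhpBarrier_start_le hbn hη0 hη2
    exact ⟨by linarith, this⟩
  have hU65 : ∀ z ∈ D, U z < 1 / 2 → ‖ψ z - ψ (Site.toComplex w)‖ ≤ 65 * η := by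
    intro z hz hUz
    have hUz' : uhpBarrier a (cayleyAt b (ψ z)) < 1 / 2 := by rwa [← barrierQ_im]
    have h1 := norm_sub_lt_of_uhpBarrier_lt_half hbn ha0 (hlt z hz) hUz'
    have h2 : ‖b - ψ (Site.toComplex w)‖ = η := by
      rw [← hζw, hζwb]
      have : b - ((1 - η : ℝ) : ℂ) * b = (η : ℂ) * b := by push_cast; ring
      rw [this, norm_mul, Complex.norm_real, Real.norm_of_nonneg hη0.le, hbn, mul_one]
    calc ‖ψ z - ψ (Site.toComplex w)‖ ≤ ‖ψ z - b‖ + ‖b - ψ (Site.toComplex w)‖ :=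
          norm_sub_le_norm_sub_add_norm_sub _ _ _
      _ ≤ 2 * a + η := by rw [norm_sub_rev, h2]; linarith
      _ ≤ 65 * η := by linarith
  -- the sets `Box₁ ⊆ sqBox p R₃`, `N`, the target `B = V ∖ N`, and the two auxiliary functions
  set N : Set (Site 2) := {v | v ∈ V ∧ v ∈ sqBox p R₃ ∧
    ‖ψ (Site.toComplex v) - ψ (Site.toComplex w)‖ ≤ M * η} with hN
  set B : Set (Site 2) := V \ N with hB
  set β : Site 2 → ℝ := fun v => hitBeforeExitProb D v (V \ sqBox p R₁) with hβ
  set hB' : Site 2 → ℝ := fun v => hitBeforeExitProb D v B with hhB'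
  have hNfin : N.Finite := (sqBox_finite p R₃).subset fun v hv => hv.2.1
  have hwN : w ∈ N := ⟨hw, sqBox_mono p hR₁R₃ hwR₁, by rw [sub_self, norm_zero]; positivity⟩
  refine ⟨N, hNfin, hwN, fun v hv _ => hv.2.2, ?_⟩
  change hB' w ≤ 1 - cA / 2
  -- Case A at a vertex `y` near the boundary (small Koebe radius)
  have caseA : ∀ y ∈ V, y ∈ sqBox p ((R₁ + 1 : ℕ) : ℤ) → U (Site.toComplex y) < 1 / 2 →
      koebeRadius ψ (Site.toComplex y) < 1260 → hB' y ≤ 1 - cA := by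
    intro y hyV hybox hUy hRy
    obtain ⟨q, hq, hqbox⟩ := exists_not_mem_of_koebeRadius_lt hD hψ hyV hRy
    rw [← hmA] at hqbox
    refine hitBeforeExitProb_le_of_near_boundary hgrid hψ.1 hmaps hyV hq hqbox (B := B) ?_
    intro u huV hubox hconf huB
    apply huB.2
    have hyw := hU65 _ hyV hUy
    refine ⟨huV, ?_, ?_⟩
    · -- boxes compose (triangle inequality; cf. `mem_sqBox_of_mem_sqBox` in `KCSignConditionLattice`)
      have h : u ∈ sqBox p (((R₁ + 1 : ℕ) : ℤ) + ((2 * mA : ℕ) : ℤ)) := by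
        rw [mem_sqBox, abs_le, abs_le] at hybox hubox ⊢; omega
      have : ((R₁ + 1 : ℕ) : ℤ) + ((2 * mA : ℕ) : ℤ) = ((R₃ : ℕ) : ℤ) := by rw [hR₃]; push_cast; ring
      rwa [this] at h
    · have hηy : 1 - ‖ψ (Site.toComplex y)‖ ≤ 66 * η := by
        have := norm_sub_norm_le (ψ (Site.toComplex w)) (ψ (Site.toComplex y))
        rw [norm_sub_rev] at this
        linarith
      have h15 : (0 : ℝ) ≤ 15 ^ (2 * mA) - 1 := by
        have : (1 : ℝ) ≤ 15 ^ (2 * mA) := one_le_pow₀ (by norm_num)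
        linarith
      calc ‖ψ (Site.toComplex u) - ψ (Site.toComplex w)‖
          ≤ ‖ψ (Site.toComplex u) - ψ (Site.toComplex y)‖ + ‖ψ (Site.toComplex y) - ψ (Site.toComplex w)‖ :=
            norm_sub_le_norm_sub_add_norm_sub _ _ _
        _ ≤ (15 ^ (2 * mA) - 1) * (1 - ‖ψ (Site.toComplex y)‖) + 65 * η := add_le_add hconf hyw
        _ ≤ (15 ^ (2 * mA) - 1) * (66 * η) + 65 * η := by gcongr
        _ ≤ M * η := by rw [hM]; nlinarith
  -- Case A at `w` itself
  by_cases hRw : koebeRadius ψ (Site.toComplex w) < 1260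
  · have h := caseA w hw (sqBox_mono p (by push_cast; linarith) hwR₁) hUw.1 hRw
    linarith
  push Not at hRw
  -- Case B: comparison on `W`
  set W : Set (Site 2) := {v | v ∈ V ∧ v ∈ sqBox p R₁ ∧ 1260 ≤ koebeRadius ψ (Site.toComplex v) ∧
    U (Site.toComplex v) < 1 / 2} with hW
  set F : Site 2 → ℝ := fun v => √(min (U (Site.toComplex v)) (1 / 2)) with hF
  set S : Site 2 → ℝ := fun v => 1 - cA * (1 - √2 * F v - β v) with hS
  have hWfin : W.Finite := (sqBox_finite p R₁).subset fun v hv => hv.2.1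
  have hWN : W ⊆ N := fun v hv =>
    ⟨hv.1, sqBox_mono p hR₁R₃ hv.2.1, (hU65 _ hv.1 hv.2.2.2).trans (by nlinarith)⟩
  set Gr := ChordalLERW.siteGraph V with hGr
  have hsub : IsKilledSubharmonicOn Gr hB' W :=
    ((hitBeforeExitProb_isKilledHarmonicOn D B).mono fun v hv hvB => hvB.2 (hWN hv)).subharmonicOn
  -- the four neighbours of a point of `W` are vertices
  have hnbr : ∀ v ∈ W, ∀ e : SRW.Dir 2, v + SRW.stepVec e ∈ V := by
    intro v hv e
    apply ball_koebeRadius_subset hopen hψ hv.1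
    rw [mem_ball, dist_eq_norm, norm_toComplex_sub_of_adj (zdGraph_adj_add_stepVec v e)]
    linarith [hv.2.2.1]
  have hadjW : ∀ v ∈ W, ∀ e : SRW.Dir 2, Gr.Adj v (v + SRW.stepVec e) := fun v hv e =>
    (siteGraph_adj_add_stepVec_iff v e).2 ⟨hv.1, hnbr v hv e⟩
  have havg : ∀ v ∈ W, ∀ f : Site 2 → ℝ, killedAvg Gr f v = 4⁻¹ * ∑ e : SRW.Dir 2, f (v + SRW.stepVec e) :=
    fun v hv f => by
      rw [killedAvg_def]
      congr 1
      exact Finset.sum_congr rfl fun e _ => if_pos (hadjW v hv e)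
  have key : ∀ x, S x = (1 - cA) + cA * √2 * F x + cA * β x := fun x => by
    simp only [hS]; ring
  -- `S` is killed-superharmonic on `W`
  have hsuper : IsKilledSuperharmonicOn Gr S W := by
    intro v hv
    have hβharm : β v = killedAvg Gr β v :=
      hitBeforeExitProb_isKilledHarmonicOn D (V \ sqBox p R₁) v fun h => h.2 hv.2.1
    rw [havg v hv] at hβharm
    have hFv : F v = √(U (Site.toComplex v)) := by
      show √(min (U (Site.toComplex v)) (1 / 2)) = _; rw [min_eq_left hv.2.2.2.le]
    have hFsum : ∑ e : SRW.Dir 2, F (v + SRW.stepVec e) ≤ 4 * F v := by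
      rw [hFv]
      calc ∑ e : SRW.Dir 2, F (v + SRW.stepVec e)
          ≤ ∑ e : SRW.Dir 2, √(U (Site.toComplex (v + SRW.stepVec e))) :=
            Finset.sum_le_sum fun e _ => Real.sqrt_le_sqrt (min_le_left _ _)
        _ ≤ 4 * √(U (Site.toComplex v)) := sum_sqrt_barrierQ_im_le hopen hψ hbn ha0 hv.1 hv.2.2.1 hv.2.2.2
    rw [havg v hv]
    have hsplit : 4⁻¹ * ∑ e : SRW.Dir 2, S (v + SRW.stepVec e) =
        (1 - cA) + cA * √2 * (4⁻¹ * ∑ e : SRW.Dir 2, F (v + SRW.stepVec e)) +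
          cA * (4⁻¹ * ∑ e : SRW.Dir 2, β (v + SRW.stepVec e)) := by
      simp_rw [key]
      rw [Finset.sum_add_distrib, Finset.sum_add_distrib, Finset.sum_const, Finset.card_univ,
        SRW.card_dir, ← Finset.mul_sum, ← Finset.mul_sum, nsmul_eq_mul]
      push_cast
      ring
    rw [hsplit, ← hβharm, key v]
    have h1 : 4⁻¹ * ∑ e : SRW.Dir 2, F (v + SRW.stepVec e) ≤ F v := by linarith
    gcongr
  -- `hB' ≤ S` on the outer boundary of `W`
  have hbd : ∀ y ∈ killedOuterBoundary Gr W, hB' y ≤ S y := by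
    intro y hy
    obtain ⟨hyW, v, hv, e, rfl, -⟩ := mem_killedOuterBoundary_iff.1 hy
    have hyV : v + SRW.stepVec e ∈ V := hnbr v hv e
    have hybox : v + SRW.stepVec e ∈ sqBox p ((R₁ + 1 : ℕ) : ℤ) := by
      have h := mem_sqBox_succ_of_adj hv.2.1 (zdGraph_adj_add_stepVec v e)
      exact_mod_cast h
    have hF0 : 0 ≤ F (v + SRW.stepVec e) := Real.sqrt_nonneg _
    have hβ0 : 0 ≤ β (v + SRW.stepVec e) := hitBeforeExitProb_nonneg D _ _
    have hle1 : hB' (v + SRW.stepVec e) ≤ 1 := hitBeforeExitProb_le_one D _ _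
    have h2 : (0 : ℝ) ≤ √2 := Real.sqrt_nonneg _
    rw [key]
    by_cases hbox : v + SRW.stepVec e ∈ sqBox p R₁
    · by_cases hUy : U (Site.toComplex (v + SRW.stepVec e)) < 1 / 2
      · -- small Koebe radius: Case A
        have hR : koebeRadius ψ (Site.toComplex (v + SRW.stepVec e)) < 1260 := by
          by_contra h
          exact hyW ⟨hyV, hbox, not_lt.1 h, hUy⟩
        have hA := caseA _ hyV hybox hUy hR
        nlinarith [mul_nonneg hcA0.le (mul_nonneg h2 hF0), mul_nonneg hcA0.le hβ0]
      · -- `U ≥ 1/2`: `√2 F = 1`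
        have hFy : F (v + SRW.stepVec e) = √(1 / 2) := by
          show √(min (U (Site.toComplex (v + SRW.stepVec e))) (1 / 2)) = _
          rw [min_eq_right (not_lt.1 hUy)]
        have h21 : √2 * √(1 / 2) = 1 := by
          rw [← Real.sqrt_mul (by norm_num)]; norm_num
        rw [hFy, mul_assoc, h21]
        nlinarith [mul_nonneg hcA0.le hβ0]
    · -- outside `Box₁`: `β = 1`
      have hβy : β (v + SRW.stepVec e) = 1 := hitBeforeExitProb_eq_one_of_mem D ⟨hyV, hbox⟩
      rw [hβy]
      nlinarith [mul_nonneg hcA0.le (mul_nonneg h2 hF0)]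
  -- the comparison principle at `w ∈ W`
  have hwW : w ∈ W := ⟨hw, hwR₁, hRw, hUw.1⟩
  have hcomp := le_of_killedSub_killedSuper_of_boundary hWfin hsub hsuper hbd w hwW
  -- `S w ≤ 1 - cA/2`
  have hβw : β w ≤ 1 / 4 := hK D hgrid hsc p hp ρ w hw hwρ
  have hFw : √2 * F w ≤ 1 / 4 := by
    have h1 : F w ≤ √(1 / 32) := by
      show √(min (U (Site.toComplex w)) (1 / 2)) ≤ _
      exact Real.sqrt_le_sqrt ((min_le_left _ _).trans hUw.2)
    have h2 : √2 * √(1 / 32) = 1 / 4 := by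
      rw [← Real.sqrt_mul (by norm_num), show (2 * (1 / 32) : ℝ) = (1 / 4) ^ 2 by norm_num,
        Real.sqrt_sq (by norm_num)]
    calc √2 * F w ≤ √2 * √(1 / 32) := mul_le_mul_of_nonneg_left h1 (Real.sqrt_nonneg _)
      _ = 1 / 4 := h2
  rw [key] at hcomp
  nlinarith [hcomp, mul_le_mul_of_nonneg_left hFw hcA0.le, mul_le_mul_of_nonneg_left hβw hcA0.le]

end LSWGrid

/-- **Lawler–Schramm–Werner (2004), Lemma 5.3 (boundary hitting)**: for every `ε₁, ε₂ > 0` there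
is `δ > 0` such that for every `D ∈ 𝔇`, its disc map `ψ_D` and every `w ∈ V(D)` with
`|ψ_D(w)| ≥ 1 - δ`, simple random walk from `w` hits `{v ∈ V(D) : |ψ_D(v) - ψ_D(w)| > ε₁}` before
`∂D` with probability at most `ε₂` — the named fact `boundaryHitting` holds (one-round lemma
`LSWGrid.oneRound` iterated by `LSWGrid.boundaryHitting_of_oneRound`).
[cite: LawlerSchrammWerner2004, Lemma 5.3] -/
theorem boundaryHitting_holds : boundaryHitting := by
  obtain ⟨M, c₂, δ₀, hM, hc₂, hc₂1, hδ₀, H⟩ := LSWGrid.oneRound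
  exact LSWGrid.boundaryHitting_of_oneRound hM hc₂ hc₂1 hδ₀ H

end Literature.Probability.LatticeModels
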